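import Literature.Probability.RandomPlanarGeometry.SAWKestenHairpin
import Literature.Probability.RandomPlanarGeometry.SAWHairpinDensity
import Literature.Probability.RandomPlanarGeometry.SAWLowerBound25
import HarnessLib

/-!
# The hairpin pattern theorem and the explicit Kesten ratio rate on `ℤ²` with STANDARD axioms

Topic `Literature/Probability/RandomPlanarGeometry` (lane pcv-sawmu item X25 «K-ONLY», parts K2–K3; twins of
`SAWHairpinDensity.lean` / `SAWKestenRatioRateZ2.lean`). The tree theorems `Zd.hairpin_density_explicit`
(`Q = 320`) and `KestenHairpin.kestenRatioRateZ2` rest on `μ(ℤ²) ≥ 2.604`, a strip-transfer-matrix evaluation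
certified by `native_decide`. Replacing that input by the standard-axiom bound `μ(ℤ²) ≥ 5/2`
(`Zd.le_connectiveConstant_two_25`, `SAWLowerBound25.lean`) and the block length `20` by `40`
(`#{hairpin-free 40-step walks} ≤ uTurnFreeSeq 39 = 4 093 147 632 754 948 ≤ 0.495 · (5/2)^40`,
`c_40 ≤ 4·3^39 ≤ 1960 · (5/2)^40`, `0.7475^34 ≤ 0.505/7840`, so `q₂ = 34`, `Q = 40·34 = 1360`) gives the same
chain with NO evaluation axiom:

* `Zd.hairpin_density_explicit_25` — Madras–Slade Theorem 7.2.3 for tight U-turns, `Q = 1360`, `C = Σ_{r<40} c_r`;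
* `KestenHairpin.hairpinSparse_Z2_25`, `kestenIneqZ2_std` (Kesten's (7.3.3) with `B = kestenB 0 1360 (Σ_{r<40} c_r)`),
  `ratioRate_Z2_std`, **`kestenRatioRateZ2_std`** — the lane's typed `KestenRatioRateZ2` shape (with `K ≥ 0`
  recorded; the bare `∃ K` statement is the tree's `kestenRatioRateZ2`), axioms `[propext, Classical.choice, Quot.sound]`.

The constant is `(1360/320)³ ≈ 77` times the certified-input one; the statement shapes are identical.

## References

* N. Madras, G. Slade, *The Self-Avoiding Walk* (1993), Lemma 7.2.5, Theorem 7.2.3, Lemma 7.3.1, Theorem 7.3.2, §7.5.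
* H. Kesten, *On the number of self-avoiding walks*, J. Math. Phys. 4 (1963) 960–969.
-/

noncomputable section

open Finset
open Literature.Probability.LatticeModels (Site zdGraph)
open scoped BigOperators

namespace Literature.Probability.RandomPlanarGeometry.SAW

/-! ### K2: the pattern theorem for tight U-turns at base `5/2`, block length `40` -/

/-- `uTurnFreeSeq 39 = 4 093 147 632 754 948` (the number of U-turn-free words of length `40`). [folklore] -/
private theorem uTurnFreeSeq_thirtyNine : uTurnFreeSeq 39 = 4093147632754948 := by decide

/-- `(5/2)^n ≤ μ(ℤ²)^n`. [folklore] -/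
private theorem pow_le_connectiveConstant_pow_25 (n : ℕ) : (5 / 2 : ℝ) ^ n ≤ Zd.connectiveConstant 2 ^ n :=
  pow_le_pow_left₀ (by norm_num) Zd.le_connectiveConstant_two_25 n

/-- **Kesten's pattern theorem for tight U-turns on `ℤ²`, explicit constants, standard axioms** (block length
`m = 40`, `q₂ = 34`, `Q = 1360`, `C = Σ_{r<40} c_r`): for every `N`,
`#{ω ∈ S_N : #U-turns ≤ N/5440} ≤ (Σ_{r<40} c_r) · 2^{-⌊N/1360⌋} · μ^N`.
Inputs: `#goodWalks hairpinAt 40 ≤ 4 093 147 632 754 948 ≤ 0.495·(5/2)^40`, `c_40 ≤ 4·3^39 ≤ 1960·(5/2)^40`,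
`0.7475^34 ≤ 0.505/7840`, and `μ ≥ 5/2` (`SAWLowerBound25.lean`, standard axioms). The constants are this
formalisation's. [cite: MadrasSlade1993, Theorem 7.2.3 (instance: the U-turn pattern on ℤ², via Lemma 7.2.5)] -/
theorem Zd.hairpin_density_explicit_25 (N : ℕ) :
    (((Zd.saws 2 N).filter fun ω => Zd.occ Zd.hairpinAt N ω ≤ N / (4 * 1360)).card : ℝ) ≤
      (∑ r ∈ Finset.range 40, (Zd.count 2 r : ℝ)) * (1 / 2) ^ (N / 1360) * Zd.connectiveConstant 2 ^ N := by
  have h40 := pow_le_connectiveConstant_pow_25 40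
  have hG : ((Zd.goodWalks (d := 0) Zd.hairpinAt 40).card : ℝ) ≤ 0.495 * Zd.connectiveConstant 2 ^ 40 := by
    have h1 : ((Zd.goodWalks (d := 0) Zd.hairpinAt 40).card : ℝ) ≤ 4093147632754948 := by
      have := Zd.card_goodWalks_hairpinAt_succ_le_uTurnFreeSeq 39
      rw [uTurnFreeSeq_thirtyNine] at this
      exact_mod_cast this
    have h2 : (4093147632754948 : ℝ) ≤ 0.495 * (5 / 2 : ℝ) ^ 40 := by norm_num
    exact h1.trans (h2.trans (mul_le_mul_of_nonneg_left h40 (by norm_num)))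
  have hc : (Zd.count 2 40 : ℝ) ≤ 1960 * Zd.connectiveConstant 2 ^ 40 := by
    have h0 : Zd.count 2 40 ≤ 16210220612075905068 := by
      have := Zd.count_succ_le 2 39
      norm_num at this
      exact this
    have h1 : (Zd.count 2 40 : ℝ) ≤ 16210220612075905068 := by exact_mod_cast h0
    have h2 : (16210220612075905068 : ℝ) ≤ 1960 * (5 / 2 : ℝ) ^ 40 := by norm_num
    exact h1.trans (h2.trans (mul_le_mul_of_nonneg_left h40 (by norm_num)))
  have hq : ((1 + (0.495 : ℝ)) / 2) ^ 34 ≤ (1 - 0.495) / (4 * 1960) := by norm_num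
  exact Zd.lemma725_explicit (d := 0) (by norm_num) (Zd.restricts_hairpinAt 0 40) (by norm_num) hG hc hq
    (show 1360 = 40 * 34 by norm_num) N

/-! ### K3: Kesten's inequality and the explicit ratio rate, standard axioms -/

namespace Zd.KestenHairpin

/-- **The hairpin-sparsity input on `ℤ²` with standard axioms**: `Q = 1360`, `C = Σ_{r<40} c_r`.
[cite: MadrasSlade1993, Theorem 7.2.3 (U-turn instance, explicit; via Lemma 7.2.5)] -/
theorem hairpinSparse_Z2_25 : HairpinSparse 0 1360 (∑ r ∈ Finset.range 40, (count 2 r : ℝ)) := by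
  intro N
  have h := Zd.hairpin_density_explicit_25 N
  exact h

/-- **Kesten's inequality (7.3.3) on `ℤ²`, explicit constant, standard axioms**:
`c_{n+2}/c_n − B/n ≤ c_{n+4}/c_{n+2}` for all `n ≥ 1` with `B = kestenB 0 1360 (Σ_{r<40} c_r)`.
[cite: MadrasSlade1993, Lemma 7.3.1, eq. (7.3.3) and Theorem 7.3.2 (a) (explicit constant)] -/
theorem kestenIneqZ2_std : KestenIneqZ2 (kestenB 0 1360 (∑ r ∈ Finset.range 40, (count 2 r : ℝ))) :=
  kestenIneqZ2_of_hairpinSparse (by norm_num) hairpinSparse_Z2_25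

/-- **Kesten's ratio limit theorem on `ℤ²` with an explicit rate, standard axioms**: for every `N ≥ 1`,
`|c_{N+2}/c_N − μ²| ≤ μ √(12 (B + 16) (G(2N) + 1)/N)` with `B = kestenB 0 1360 (Σ_{r<40} c_r)`,
`G = KestenRate.hwEnvelope μ`. [cite: MadrasSlade1993, §7.5, eq. (7.5.1) and Theorem 7.3.2 (a) (quantitative form,
unconditional on ℤ²)] -/
theorem ratioRate_Z2_std {N : ℕ} (hN : 1 ≤ N) :
    |(count 2 (N + 2) : ℝ) / count 2 N - connectiveConstant 2 ^ 2| ≤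
      connectiveConstant 2 *
        Real.sqrt (12 * (kestenB 0 1360 (∑ r ∈ Finset.range 40, (count 2 r : ℝ)) + 16) *
          (KestenRate.hwEnvelope (connectiveConstant 2) (2 * N) + 1) / N) := by
  have h := ratioRate_of_hairpinSparse (d := 0) (by norm_num) hairpinSparse_Z2_25 hN
  have e2 : (2 * (((0 : ℕ) : ℝ) + 2)) ^ 2 = 16 := by norm_num
  rw [e2] at h
  exact h

/-- The lane's typed `KestenRatioRateZ2` shape with the constant's sign recorded, standard axioms:
`∃ K ≥ 0, ∀ N ≥ 1, |c_{N+2}/c_N − μ²| ≤ K √((G(2N)+1)/N)` (`K = μ √(12 (B + 16))`; the bare `∃ K` statement is the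
tree's `kestenRatioRateZ2`, proved there through the certified `μ ≥ 2.604`; this strengthening avoids that input).
[cite: MadrasSlade1993, §7.5, eq. (7.5.1) (quantitative form, unconditional on ℤ²)] -/
theorem kestenRatioRateZ2_std :
    ∃ K : ℝ, 0 ≤ K ∧ ∀ N : ℕ, 1 ≤ N →
      |(count 2 (N + 2) : ℝ) / count 2 N - connectiveConstant 2 ^ 2| ≤
        K * Real.sqrt ((KestenRate.hwEnvelope (connectiveConstant 2) (2 * N) + 1) / N) := by
  set B := kestenB 0 1360 (∑ r ∈ Finset.range 40, (count 2 r : ℝ)) with hB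
  have hC0 : 0 ≤ ∑ r ∈ Finset.range 40, (count 2 r : ℝ) := Finset.sum_nonneg (fun _ _ => Nat.cast_nonneg _)
  have hB0 : 0 ≤ B := by
    rw [hB]; unfold kestenB; positivity
  have hμ : 0 ≤ connectiveConstant 2 := (connectiveConstant_pos 2).le
  refine ⟨connectiveConstant 2 * Real.sqrt (12 * (B + 16)), by positivity, fun N hN => ?_⟩
  have h := ratioRate_Z2_std hN
  rw [← hB] at h
  have e : 12 * (B + 16) * (KestenRate.hwEnvelope (connectiveConstant 2) (2 * N) + 1) / N =
      (12 * (B + 16)) * ((KestenRate.hwEnvelope (connectiveConstant 2) (2 * N) + 1) / N) := by ring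
  rw [e, Real.sqrt_mul (by positivity), ← mul_assoc] at h
  exact h

end Zd.KestenHairpin

end Literature.Probability.RandomPlanarGeometry.SAW
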